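import Summits.CriticalPhenomena.PercolationContinuityZ3.Theorems.PercNearOneGluingNoHeavyConstsUnconditionalChainRule
import Mathlib.LinearAlgebra.Matrix.Determinant.Basic
import HarnessLib
import HarnessLib.Audit.Tags

/-!
# The single-edge chain rule for an avoided vertex hanging from `o` or from `v`: THEOREMS, completing the "pendant `Y`" family
# (PAPER-2 track (ii): constants of the CSH family)

builds on p205010 (kernel theorem, internal audit signed; external expert review pending).  Support file (`--supports
stmt-CriticalPhenomena-4575`), seat `prim-consts-2` (gen 7); rows A6/A11 of `run/shared/lean/prim/consts/CONSTANTS.md`; memo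
`run/shared/lean/prim/consts/FROM-prim-consts-2-g7-ROW-SPLIT.md` §8.  No definitions, no named facts, no sorries; standard axioms.

Notation `K(S,T) = μ{S ↮ T}`; CR = `Consts.SingleEdgeChainRule` (OPEN) = `0 ≤ Δ(Y) := det[K(S_i, Y ∪ τ_j)]`, `S = ({x},{x,u},{x,u,v})`,
`τ = ({v},∅,{o})`; `Δ₀ := Δ(∅) ≥ 0` is van den Berg–Häggström–Kahn's Theorem 1.3 (`Consts.singleEdgeChainRule_of_isEmpty`).
THE PENDANT FAMILY.  Let `Y = {y}` where `y` has a single possible neighbour `t`, edge weight `q`, and let `K₀` be the kernel of the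
graph without `y`, so that `K(S, {y} ∪ T) = (1−q) K₀(S,T) + q K₀(S, T ∪ {t})` if `t ∉ S` and `= (1−q) K₀(S,T)` if `t ∈ S`.  Expanding
the determinant (elementary; rows or columns that agree up to the factor `1−q` are combined):
* `t = x`:  `Δ = (1−q)³ Δ₀`;
* `t = v`:  `Δ = (1−q) · [(1−q) Δ₀ + q · L₀]`,  `L₀ = K(xu,v)K(x,vo) − K(x,v)K(xu,vo) ≥ 0` (reverse regularity, `Consts.disconnect_rr2`);
* `t = o`:  `Δ = (1−q) · [(1−q) Δ₀ + q · D₀]`,  `D₀ = det [[K(x,vo),1,K(x,o)],[K(xu,vo),1,K(xu,o)],[0,1,K(xuv,o)]]` — **this file,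
  `Consts.chainRule_voAvoid_noTarget`: `D₀ ≥ 0`** (Theorem 1.3 of vdBHK for the cluster of the SET `{v,o}` given `{v,o} ↮ x`: the
  increasing event `{v ↔ o}` and the decreasing event `{u ∉ C_v ∪ C_o}` are negatively correlated; `Consts.real_avoid_conn_mul_conn_le`);
* `t = u`:  `Δ = (1−q)² · [(1−q) Δ₀ + q · A₀]`, `A₀ ≥ 0` = `Consts.chainRule_uAvoid_noTarget` (`T/…ConstsChainRulePendantU.lean`, p305368;
  the only case that needs the marker dominance lemma).
So **the single-edge chain rule holds whenever the avoided vertex is attached to exactly one of the four named points** — with the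
between-world mechanism visible only at `t = u`.  (A vertex `y` attached to a generic fifth vertex `z` gives back CR with `Y = {z}`
at `q = 1`: no reduction.)  For the record this file also proves the `t = v` coefficient in determinant form,
`Consts.chainRule_pendantV_coeff`: `det[[K(x,v),K(x,v),K(x,vo)],[K(xu,v),1,K(xu,o)],[0,1,K(xuv,o)]] + det[[K(x,v),1,K(x,o)],[K(xu,v),K(xu,v),K(xu,vo)],
[0,1,K(xuv,o)]] = Δ₀ + L₀ ≥ 0` (the two row-mixed minors of the naive row expansion; individually the second one is two-signed).
[cite: VandenbergHaggstromKahn2005, Thm. 1.3 (p. 6) with Remark 1 after Thm. 1.2 (p. 5), Thm. 1.5 (p. 7)]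
-/

noncomputable section

namespace Summit.CriticalPhenomena.PercolationContinuityZ3.Theorems

open MeasureTheory Set Literature.Probability.LatticeModels Literature.Probability.Percolation
open scoped Classical

namespace Consts

/-- Notation (this file only): the disconnection kernel `𝕂[w](S, T) = μ_w{S ↮ T}`. -/
local notation3 "𝕂[" w "](" S ", " T ")" =>
  MeasureTheory.Measure.real (prodBernoulli w) {ω | ∀ s ∈ S, ∀ t ∈ T, ¬ (openGraph ω).Reachable s t}

variable {V : Type*} [Fintype V]

/-- **THEOREM — the `{v,o}`-avoiding chain rule (`D₀ ≥ 0`); equivalently, the single-edge chain rule for an avoided vertex pendant at `o`.**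
For every finite weighted graph and all `x, u, v, o`:
`0 ≤ det [[K(x,{v,o}), K(x,∅), K(x,{o})], [K(xu,{v,o}), K(xu,∅), K(xu,{o})], [K(xuv,{v,o}), K(xuv,∅), K(xuv,{o})]]`
`= K(xu,vo)·[K(x,o) − K(xuv,o)] − K(x,vo)·[K(xu,o) − K(xuv,o)]`, i.e. `P(u ↮ {v,o} | x ↮ {v,o}) · μ(o ∈ C_{uv} ∖ C_x) ≥ μ(o ∈ C_v ∖ C_{xu})`
(stronger than the `Y = ∅` chain rule, whose coefficient is `P(u ↮ v | x ↮ v) ≥ P(u ↮ vo | x ↮ vo)`).  Proof: `{o ∈ C_v, v ↮ x} ⊆ {o ∈ C_{uv} ∖ C_x}`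
and, given `D' = {{v,o} ↮ x}`, vdBHK's Theorem 1.3 for the source set `{v,o}`: `μ(D' ∩ {v↔o} ∩ {u ∉ C_{vo}}) μ(D') ≤ μ(D' ∩ {v↔o}) μ(D' ∩ {u ∉ C_{vo}})`.
[cite: VandenbergHaggstromKahn2005, Thm. 1.3 (p. 6) with Remark 1 after Thm. 1.2 (p. 5)] -/
theorem chainRule_voAvoid_noTarget (w : Sym2 V → unitInterval) (x u v o : V) :
    0 ≤ Matrix.det !![
      𝕂[w](({x} : Set V), ({v, o} : Set V)), 𝕂[w](({x} : Set V), (∅ : Set V)), 𝕂[w](({x} : Set V), ({o} : Set V));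
      𝕂[w](({x, u} : Set V), ({v, o} : Set V)), 𝕂[w](({x, u} : Set V), (∅ : Set V)), 𝕂[w](({x, u} : Set V), ({o} : Set V));
      𝕂[w](({x, u, v} : Set V), ({v, o} : Set V)), 𝕂[w](({x, u, v} : Set V), (∅ : Set V)),
        𝕂[w](({x, u, v} : Set V), ({o} : Set V))] := by
  classical
  set μ := prodBernoulli w with hμ
  have hmeas : ∀ T : Set (BondConfig V), MeasurableSet T := fun _ => MeasurableSet.of_discrete
  set p := 𝕂[w](({x} : Set V), ({v, o} : Set V)) with hp
  set c := 𝕂[w](({x} : Set V), ({o} : Set V)) with hc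
  set s := 𝕂[w](({x, u} : Set V), ({v, o} : Set V)) with hs
  set t := 𝕂[w](({x, u} : Set V), ({o} : Set V)) with ht
  set z := 𝕂[w](({x, u, v} : Set V), ({o} : Set V)) with hz
  -- trivial entries
  have hempty : ∀ S : Set V, 𝕂[w](S, (∅ : Set V)) = 1 := by
    intro S
    have : {ω : BondConfig V | ∀ s' ∈ S, ∀ t' ∈ (∅ : Set V), ¬ (openGraph ω).Reachable s' t'} = univ := by ext ω; simp
    rw [this]; simp
  have hK3 : 𝕂[w](({x, u, v} : Set V), ({v, o} : Set V)) = 0 := by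
    have : {ω : BondConfig V | ∀ s' ∈ ({x, u, v} : Set V), ∀ t' ∈ ({v, o} : Set V), ¬ (openGraph ω).Reachable s' t'} = ∅ := by
      ext ω
      simp only [mem_setOf_eq, mem_empty_iff_false, iff_false, not_forall, not_not]
      exact ⟨v, by simp, v, by simp, SimpleGraph.Reachable.refl _⟩
    rw [this]; simp
  -- the events of the set source `{v,o}` avoiding `x`
  set D : Set (BondConfig V) := {ω | ∀ s' ∈ ({v, o} : Set V), ∀ t' ∈ ({x} : Set V), ¬ (openGraph ω).Reachable s' t'} with hD
  set W : Set (BondConfig V) := {ω | ∃ s' ∈ ({v} : Set V), ∃ a ∈ ({o} : Set V), (openGraph ω).Reachable s' a} with hW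
  set U : Set (BondConfig V) := {ω | ∃ s' ∈ ({v, o} : Set V), ∃ a ∈ ({u} : Set V), (openGraph ω).Reachable s' a} with hU
  have key := real_avoid_conn_mul_conn_le w ({v, o} : Set V) ({x} : Set V) (S₁ := {v}) (S₂ := {v, o})
    (by intro a ha; rw [mem_singleton_iff] at ha; subst ha; exact mem_insert _ _) subset_rfl ({o} : Set V) ({u} : Set V)
  -- key : μ.real (D ∩ W) * μ.real (D ∩ U) ≤ μ.real D * μ.real (D ∩ (W ∩ U))
  change μ.real (D ∩ W) * μ.real (D ∩ U) ≤ μ.real D * μ.real (D ∩ (W ∩ U)) at key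
  -- identify `μ(D) = p`, `μ(D ∩ Uᶜ) = s`, `μ(D ∩ W ∩ Uᶜ) = t − z`, `μ(D ∩ W) ≤ c − z`
  have hDp : μ.real D = p := by rw [hp, hD, setOf_avoid_comm]
  have hDU : μ.real (D \ U) = s := by
    rw [hs]; congr 1; ext ω
    simp only [hD, hU, mem_sdiff, mem_setOf_eq, mem_insert_iff, mem_singleton_iff, forall_eq_or_imp, forall_eq, exists_eq_or_imp,
      exists_eq_left, not_or]
    constructor
    · rintro ⟨⟨hvx, hox⟩, hvu, hou⟩
      exact ⟨⟨fun h => hvx h.symm, fun h => hox h.symm⟩, ⟨fun h => hvu h.symm, fun h => hou h.symm⟩⟩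
    · rintro ⟨⟨hxv, hxo⟩, huv, huo⟩
      exact ⟨⟨fun h => hxv h.symm, fun h => hxo h.symm⟩, fun h => huv h.symm, fun h => huo h.symm⟩
  have hDWU : μ.real ((D ∩ W) \ U) = t - z := by
    have hsub : {ω : BondConfig V | ∀ s' ∈ ({x, u, v} : Set V), ∀ t' ∈ ({o} : Set V), ¬ (openGraph ω).Reachable s' t'} ⊆
        {ω : BondConfig V | ∀ s' ∈ ({x, u} : Set V), ∀ t' ∈ ({o} : Set V), ¬ (openGraph ω).Reachable s' t'} := by
      intro ω h; simp only [mem_setOf_eq] at h ⊢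
      exact fun s' hs' t' ht' => h s' (by simp only [mem_insert_iff, mem_singleton_iff] at hs' ⊢; tauto) t' ht'
    have hdiff : {ω : BondConfig V | ∀ s' ∈ ({x, u} : Set V), ∀ t' ∈ ({o} : Set V), ¬ (openGraph ω).Reachable s' t'} \
        {ω : BondConfig V | ∀ s' ∈ ({x, u, v} : Set V), ∀ t' ∈ ({o} : Set V), ¬ (openGraph ω).Reachable s' t'} = (D ∩ W) \ U := by
      ext ω
      simp only [mem_sdiff, mem_setOf_eq, mem_insert_iff, mem_singleton_iff, forall_eq_or_imp, forall_eq, hD, hW, hU,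
        mem_inter_iff, exists_eq_or_imp, exists_eq_left, not_or]
      constructor
      · rintro ⟨⟨hxo, huo⟩, h2⟩
        have hvo : (openGraph ω).Reachable v o := by
          by_contra hvo; exact h2 ⟨hxo, huo, hvo⟩
        exact ⟨⟨⟨fun hvx => hxo (hvx.symm.trans hvo), fun hox => hxo hox.symm⟩, hvo⟩,
          fun hvu => huo (hvu.symm.trans hvo), fun hou => huo hou.symm⟩
      · rintro ⟨⟨⟨hvx, hox⟩, hvo⟩, hvu, hou⟩
        exact ⟨⟨fun hxo => hox hxo.symm, fun huo => hou huo.symm⟩, fun h => h.2.2 hvo⟩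
    rw [ht, hz, ← measureReal_sdiff hsub (hmeas _), hdiff]
  have hDW : μ.real (D ∩ W) ≤ c - z := by
    have hsub : {ω : BondConfig V | ∀ s' ∈ ({x, u, v} : Set V), ∀ t' ∈ ({o} : Set V), ¬ (openGraph ω).Reachable s' t'} ⊆
        {ω : BondConfig V | ∀ s' ∈ ({x} : Set V), ∀ t' ∈ ({o} : Set V), ¬ (openGraph ω).Reachable s' t'} := by
      intro ω h; simp only [mem_setOf_eq] at h ⊢
      exact fun s' hs' t' ht' => h s' (by simp only [mem_insert_iff, mem_singleton_iff] at hs' ⊢; tauto) t' ht'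
    have hsub2 : D ∩ W ⊆ {ω : BondConfig V | ∀ s' ∈ ({x} : Set V), ∀ t' ∈ ({o} : Set V), ¬ (openGraph ω).Reachable s' t'} \
        {ω : BondConfig V | ∀ s' ∈ ({x, u, v} : Set V), ∀ t' ∈ ({o} : Set V), ¬ (openGraph ω).Reachable s' t'} := by
      rintro ω ⟨hDω, hWω⟩
      simp only [hD, hW, mem_setOf_eq, mem_insert_iff, mem_singleton_iff, forall_eq_or_imp, forall_eq, exists_eq_left] at hDω hWω
      simp only [mem_sdiff, mem_setOf_eq, mem_insert_iff, mem_singleton_iff, forall_eq_or_imp, forall_eq]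
      exact ⟨fun hxo => hDω.1 (hWω.trans hxo.symm), fun h => h.2.2 hWω⟩
    rw [hc, hz, ← measureReal_sdiff hsub (hmeas _)]
    exact measureReal_mono hsub2
  -- from PA (inc/inc) to the inc/dec form: `μ(D) μ((D ∩ W) \ U) ≤ μ(D ∩ W) μ(D \ U)`
  have e1 : μ.real ((D ∩ W) \ U) = μ.real (D ∩ W) - μ.real (D ∩ (W ∩ U)) := by
    have h := measureReal_inter_add_sdiff (μ := μ) (s := D ∩ W) (hmeas U)
    rw [show D ∩ W ∩ U = D ∩ (W ∩ U) from inter_assoc _ _ _] at h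
    linarith
  have e2 : μ.real (D \ U) = μ.real D - μ.real (D ∩ U) := by
    have h := measureReal_inter_add_sdiff (μ := μ) (s := D) (hmeas U)
    linarith
  have hineq : p * (t - z) ≤ μ.real (D ∩ W) * s := by
    rw [← hDp, ← hDWU, ← hDU, e1, e2]
    nlinarith [key, (measureReal_nonneg : 0 ≤ μ.real D), (measureReal_nonneg : 0 ≤ μ.real (D ∩ W))]
  have hs0 : 0 ≤ s := measureReal_nonneg
  have htz : 0 ≤ t - z := by rw [← hDWU]; exact measureReal_nonneg
  have hdet : Matrix.det !![p, 𝕂[w](({x} : Set V), (∅ : Set V)), c; s, 𝕂[w](({x, u} : Set V), (∅ : Set V)), t;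
      𝕂[w](({x, u, v} : Set V), ({v, o} : Set V)), 𝕂[w](({x, u, v} : Set V), (∅ : Set V)), z] = s * (c - z) - p * (t - z) := by
    rw [Matrix.det_fin_three]
    simp only [Matrix.of_apply, Matrix.cons_val', Matrix.cons_val_zero, Matrix.cons_val_one, Matrix.cons_val_two,
      Matrix.empty_val', Matrix.cons_val_fin_one, Matrix.head_cons, Matrix.tail_cons, Matrix.head_fin_const, hempty, hK3]
    ring
  rw [hdet]
  nlinarith [hDW, hineq, hs0, mul_le_mul_of_nonneg_right hDW hs0]

/-- **The pendant-at-`v` coefficient**: the sum of the two row-mixed minors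
`det[[K(x,v),K(x,v),K(x,vo)],[K(xu,v),1,K(xu,o)],[0,1,K(xuv,o)]] + det[[K(x,v),1,K(x,o)],[K(xu,v),K(xu,v),K(xu,vo)],[0,1,K(xuv,o)]]` equals
`Δ₀ + L₀` with `Δ₀ = K(xu,v)[K(x,o) − K(xuv,o)] − K(x,v)[K(xu,o) − K(xuv,o)] ≥ 0` (the `Y = ∅` chain rule) and
`L₀ = K(xu,v)K(x,vo) − K(x,v)K(xu,vo) ≥ 0` (reverse regularity), hence is nonnegative; with it the CR minor for an avoided vertex pendant
at `v` (weight `q`) is `(1−q)[(1−q)Δ₀ + qL₀] ≥ 0`. [cite: VandenbergHaggstromKahn2005, Thm. 1.3 (p. 6), Thm. 1.5 (p. 7)] -/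
theorem chainRule_pendantV_coeff (w : Sym2 V → unitInterval) (x u v o : V) :
    0 ≤ Matrix.det !![
        𝕂[w](({x} : Set V), ({v} : Set V)), 𝕂[w](({x} : Set V), ({v} : Set V)), 𝕂[w](({x} : Set V), ({v, o} : Set V));
        𝕂[w](({x, u} : Set V), ({v} : Set V)), 𝕂[w](({x, u} : Set V), (∅ : Set V)), 𝕂[w](({x, u} : Set V), ({o} : Set V));
        𝕂[w](({x, u, v} : Set V), ({v} : Set V)), 𝕂[w](({x, u, v} : Set V), (∅ : Set V)), 𝕂[w](({x, u, v} : Set V), ({o} : Set V))] +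
      Matrix.det !![
        𝕂[w](({x} : Set V), ({v} : Set V)), 𝕂[w](({x} : Set V), (∅ : Set V)), 𝕂[w](({x} : Set V), ({o} : Set V));
        𝕂[w](({x, u} : Set V), ({v} : Set V)), 𝕂[w](({x, u} : Set V), ({v} : Set V)), 𝕂[w](({x, u} : Set V), ({v, o} : Set V));
        𝕂[w](({x, u, v} : Set V), ({v} : Set V)), 𝕂[w](({x, u, v} : Set V), (∅ : Set V)), 𝕂[w](({x, u, v} : Set V), ({o} : Set V))] := by
  classical
  set μ := prodBernoulli w with hμ
  have hmeas : ∀ T : Set (BondConfig V), MeasurableSet T := fun _ => MeasurableSet.of_discrete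
  set b := 𝕂[w](({x} : Set V), ({v} : Set V)) with hb
  set c := 𝕂[w](({x} : Set V), ({o} : Set V)) with hc
  set p := 𝕂[w](({x} : Set V), ({v, o} : Set V)) with hp
  set s := 𝕂[w](({x, u} : Set V), ({v} : Set V)) with hs
  set s' := 𝕂[w](({x, u} : Set V), ({v, o} : Set V)) with hs'
  set t := 𝕂[w](({x, u} : Set V), ({o} : Set V)) with ht
  set z := 𝕂[w](({x, u, v} : Set V), ({o} : Set V)) with hz
  have hempty : ∀ S : Set V, 𝕂[w](S, (∅ : Set V)) = 1 := by
    intro S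
    have : {ω : BondConfig V | ∀ s' ∈ S, ∀ t' ∈ (∅ : Set V), ¬ (openGraph ω).Reachable s' t'} = univ := by ext ω; simp
    rw [this]; simp
  have hK3 : 𝕂[w](({x, u, v} : Set V), ({v} : Set V)) = 0 := by
    have : {ω : BondConfig V | ∀ s' ∈ ({x, u, v} : Set V), ∀ t' ∈ ({v} : Set V), ¬ (openGraph ω).Reachable s' t'} = ∅ := by
      ext ω
      simp only [mem_setOf_eq, mem_empty_iff_false, iff_false, not_forall, not_not]
      exact ⟨v, by simp, v, rfl, SimpleGraph.Reachable.refl _⟩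
    rw [this]; simp
  -- `L₀ ≥ 0`: reverse regularity
  have hS : ({x} : Set V) ⊆ ({x, u} : Set V) := by
    intro a ha; rw [mem_singleton_iff] at ha; subst ha; exact mem_insert _ _
  have hT : ({v} : Set V) ⊆ ({v, o} : Set V) := by
    intro a ha; rw [mem_singleton_iff] at ha; subst ha; exact mem_insert _ _
  have hL : b * s' ≤ p * s := disconnect_rr2 w hS hT
  -- `Δ₀ ≥ 0`: the `Y = ∅` chain rule
  have hB : b * (t - z) ≤ s * (c - z) := by
    have h := singleEdgeChainRule_of_isEmpty w x u v o
    have hR1 : {ω : BondConfig V | ∀ y ∈ (∅ : Set V), ¬ (openGraph ω).Reachable x y} = univ := by ext ω; simp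
    have hR2 : {ω : BondConfig V | ∀ y ∈ (∅ : Set V), ¬ (openGraph ω).Reachable x y ∧ ¬ (openGraph ω).Reachable u y} = univ := by
      ext ω; simp
    have hR3 : {ω : BondConfig V | ∀ y ∈ (∅ : Set V), ¬ (openGraph ω).Reachable x y ∧ ¬ (openGraph ω).Reachable u y ∧
        ¬ (openGraph ω).Reachable v y} = univ := by
      ext ω; simp
    rw [hR1, hR2, hR3] at h
    simp only [univ_inter, probReal_univ, mul_one] at h
    have hN1 : μ.real {ω : BondConfig V | ¬ (openGraph ω).Reachable x v} = b := by
      rw [hb]; congr 1; ext ω; simp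
    have hN2 : μ.real {ω : BondConfig V | ¬ (openGraph ω).Reachable x v ∧ ¬ (openGraph ω).Reachable u v} = s := by
      rw [hs]; congr 1; ext ω
      simp only [mem_setOf_eq, mem_insert_iff, mem_singleton_iff, forall_eq_or_imp, forall_eq]
    have hA1 : μ.real (openConn x o : Set (BondConfig V)) = 1 - c := by
      have := measureReal_add_measureReal_compl (μ := μ) (hmeas (openConn x o))
      rw [probReal_univ] at this
      have hset : (openConn x o : Set (BondConfig V))ᶜ =
          {ω : BondConfig V | ∀ s' ∈ ({x} : Set V), ∀ t' ∈ ({o} : Set V), ¬ (openGraph ω).Reachable s' t'} := by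
        ext ω; simp [openConn]
      rw [hc, ← hset]; linarith
    have hA2 : μ.real (openConn x o ∪ openConn u o : Set (BondConfig V)) = 1 - t := by
      have := measureReal_add_measureReal_compl (μ := μ) (hmeas (openConn x o ∪ openConn u o))
      rw [probReal_univ] at this
      have hset : (openConn x o ∪ openConn u o : Set (BondConfig V))ᶜ =
          {ω : BondConfig V | ∀ s' ∈ ({x, u} : Set V), ∀ t' ∈ ({o} : Set V), ¬ (openGraph ω).Reachable s' t'} := by
        ext ω
        simp only [mem_compl_iff, mem_union, openConn, mem_setOf_eq, mem_insert_iff, mem_singleton_iff, forall_eq_or_imp,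
          forall_eq, not_or]
      rw [ht, ← hset]; linarith
    have hA3 : μ.real (openConn x o ∪ openConn u o ∪ openConn v o : Set (BondConfig V)) = 1 - z := by
      have := measureReal_add_measureReal_compl (μ := μ) (hmeas (openConn x o ∪ openConn u o ∪ openConn v o))
      rw [probReal_univ] at this
      have hset : (openConn x o ∪ openConn u o ∪ openConn v o : Set (BondConfig V))ᶜ =
          {ω : BondConfig V | ∀ s' ∈ ({x, u, v} : Set V), ∀ t' ∈ ({o} : Set V), ¬ (openGraph ω).Reachable s' t'} := by
        ext ω
        simp only [mem_compl_iff, mem_union, openConn, mem_setOf_eq, mem_insert_iff, mem_singleton_iff, forall_eq_or_imp,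
          forall_eq, not_or]
        tauto
      rw [hz, ← hset]; linarith
    rw [hN1, hN2, hA1, hA2, hA3] at h
    linarith
  have hdet1 : Matrix.det !![b, b, p; s, 𝕂[w](({x, u} : Set V), (∅ : Set V)), t;
      𝕂[w](({x, u, v} : Set V), ({v} : Set V)), 𝕂[w](({x, u, v} : Set V), (∅ : Set V)), z] = b * (z - t) - b * s * z + p * s := by
    rw [Matrix.det_fin_three]
    simp only [Matrix.of_apply, Matrix.cons_val', Matrix.cons_val_zero, Matrix.cons_val_one, Matrix.cons_val_two,
      Matrix.empty_val', Matrix.cons_val_fin_one, Matrix.head_cons, Matrix.tail_cons, Matrix.head_fin_const, hempty, hK3]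
    ring
  have hdet2 : Matrix.det !![b, 𝕂[w](({x} : Set V), (∅ : Set V)), c; s, s, s';
      𝕂[w](({x, u, v} : Set V), ({v} : Set V)), 𝕂[w](({x, u, v} : Set V), (∅ : Set V)), z] = b * s * z - b * s' - s * z + c * s := by
    rw [Matrix.det_fin_three]
    simp only [Matrix.of_apply, Matrix.cons_val', Matrix.cons_val_zero, Matrix.cons_val_one, Matrix.cons_val_two,
      Matrix.empty_val', Matrix.cons_val_fin_one, Matrix.head_cons, Matrix.tail_cons, Matrix.head_fin_const, hempty, hK3]
    ring
  rw [hdet1, hdet2]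
  nlinarith [hL, hB]

end Consts

end Summit.CriticalPhenomena.PercolationContinuityZ3.Theorems

end
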